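import Mathlib.RingTheory.LocalRing.Basic
import Mathlib.LinearAlgebra.Span.Basic
import HarnessLib

/-!
# Route `SignedLowerHalves`, crux L `SmallImageLowerHalfBothSigns` (stmt-BirchSwinnertonDyer-23599), line `rtt_w3` v13 — E2, row F1-carrier (5′), LEAD:
# THE COEFFICIENT EMBEDDING `σ : 𝒪_{K_v} → 𝒪_S` IS PINNED BY AN EQUIVARIANT TRANSPORT (kernel form of the LEAD's F1 design ruling)

WHY (BRIEF-E2 rev 3.1 §2 row `Col`, bus ruling 2026-08-30 «(β) F1-carrier DESIGN RULING»). The Coleman carrier `Q` of `charRoad_E2_of_localisation` is built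
from the curve-side local signed dual `XLoc_W` (Kim–Park) and the stub's transport `j : W[p^∞]|_{G_{K_v}} → (F_S/𝒪_S)(θ)`; the `𝒪_{K_v}`-structure of
`W[p^∞]|_{G_{K_v}}` (J-CURVE: `α : W[p^∞] ≃ K_v/𝒪_{K_v}(χW)`, `χW : G_{K_v} ↠ 𝒪_{K_v}ˣ` SURJECTIVE) must be matched with the `𝒪_S`-structure of the target
along SOME ring map `σ : 𝒪_{K_v} → 𝒪_S`, and the ruling says `σ` is not a choice. This file is that statement in pure algebra (`exists_unique_ringHom_of_equivariant`):
if a group `G` acts on an `O₁`-module `N` through a character `χ : G → O₁ˣ` whose image is ALL units of the LOCAL ring `O₁`, and on an `O₂`-module `M` through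
`θ : G → O₂ˣ`, and `j : N →+ M` is `G`-equivariant with `O₂`-FAITHFUL span of its image, then there is a UNIQUE ring map `σ : O₁ →+* O₂` with
`j (u • n) = σ u • j n` — every element of a local ring is a unit or `1 −` a unit, so `χ(G)` spans `O₁` over `ℤ`. THEOREMS ONLY; nothing about E2 is proved.
[cite: KimPark2017, §3 (Def. 3.13)] [folklore]
-/

set_option linter.dupNamespace false -- D-0017: single-problem summit, the namespace repeats the problem name by design
set_option autoImplicit false

namespace Summit.BirchSwinnertonDyer.BirchSwinnertonDyer.Theorems.SmallImageRttCharRoad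

universe u v w x

/-- **An equivariant transport pins the coefficient embedding.** `G` acts on the `O₁`-module `N` through `χ : G →* O₁ˣ` with `χ` ONTO the units of the
LOCAL ring `O₁`, and on the `O₂`-module `M` through `θ : G →* O₂ˣ`; `j : N →+ M` satisfies `j (χ g • n) = θ g • j n`, and `O₂` acts faithfully on the
`O₂`-span of `j(N)`. Then there is a unique ring map `σ : O₁ →+* O₂` with `j (u • n) = σ u • j n` for all `u`, `n`. [folklore] -/
theorem exists_unique_ringHom_of_equivariant {G : Type u} [Group G] {O₁ : Type v} [CommRing O₁] [IsLocalRing O₁] {O₂ : Type w} [CommRing O₂]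
    {N : Type x} [AddCommGroup N] [Module O₁ N] {M : Type x} [AddCommGroup M] [Module O₂ M]
    (χ : G →* O₁ˣ) (hχ : Function.Surjective χ) (θ : G →* O₂ˣ) (j : N →+ M)
    (hj : ∀ (g : G) (n : N), j ((χ g : O₁) • n) = (θ g : O₂) • j n)
    (hfaith : ∀ a : O₂, (∀ n : N, a • j n = 0) → a = 0) :
    ∃! σ : O₁ →+* O₂, ∀ (u : O₁) (n : N), j (u • n) = σ u • j n := by
  -- uniqueness of the multiplier attached to `u`
  have huniq : ∀ a b : O₂, (∀ n : N, a • j n = b • j n) → a = b := fun a b h ↦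
    sub_eq_zero.mp (hfaith _ fun n ↦ by rw [sub_smul, h n, sub_self])
  -- existence of the multiplier: units come from `G`, non-units are `1 - unit`
  have hex : ∀ u : O₁, ∃ a : O₂, ∀ n : N, j (u • n) = a • j n := fun u ↦ by
    rcases IsLocalRing.isUnit_or_isUnit_one_sub_self u with hu | hu
    · obtain ⟨g, hg⟩ := hχ hu.unit
      refine ⟨θ g, fun n ↦ ?_⟩
      rw [← hj, hg, IsUnit.unit_spec]
    · obtain ⟨g, hg⟩ := hχ hu.unit
      refine ⟨1 - θ g, fun n ↦ ?_⟩
      have h1 : u • n = n - (1 - u) • n := by rw [sub_smul, one_smul, sub_sub_cancel]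
      rw [h1, map_sub, ← IsUnit.unit_spec hu, ← hg, hj, sub_smul, one_smul]
  choose σf hσf using hex
  -- the ring map
  let σ : O₁ →+* O₂ :=
    { toFun := σf
      map_one' := huniq _ _ fun n ↦ by rw [← hσf, one_smul, one_smul]
      map_mul' := fun u u' ↦ huniq _ _ fun n ↦ by rw [← hσf, mul_smul, hσf, hσf, mul_smul]
      map_zero' := huniq _ _ fun n ↦ by rw [← hσf, zero_smul, map_zero, zero_smul]
      map_add' := fun u u' ↦ huniq _ _ fun n ↦ by rw [← hσf, add_smul, map_add, hσf, hσf, add_smul] }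
  refine ⟨σ, fun u n ↦ hσf u n, fun τ hτ ↦ RingHom.ext fun u ↦ huniq _ _ fun n ↦ ?_⟩
  rw [← hτ, hσf]
  rfl

end Summit.BirchSwinnertonDyer.BirchSwinnertonDyer.Theorems.SmallImageRttCharRoad
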